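import Summits.ValiantsHypothesis.ValiantsHypothesis.Theorems.ToricFixedPoints.Negative.FormDeborderingZExponent

/-!
# `ToricFixedPoints` / line `form_then_lift`, stub F1 at general `(n,m)`: semi-invariants of
`H₀(n,m)` are `z`-free

Second half of Disproof §6b in the kernel.  `FormDeborderingZExponent.h0_zExponent_eq` (the `z`-torus)
gives a common exponent `D` of each `z`-variable `X p` on the support of a semi-invariant `F`; the
unipotent element `transvection (0,0) p 1 ∈ H₀(n,m)` (it acts by `X p ↦ X p + ℓ`, `ℓ = X (0,0)`, and
satisfies the four matrix conditions verbatim because `rk (0,0) = 0`) then forces `D = 0`: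
writing `F = X_p^D · G` (`G = F|_{X_p = 1}`), semi-invariance reads `(X_p + ℓ)^D · G = e · X_p^D · G`,
and killing `X_p` gives `ℓ^D = 0` unless `D = 0`.

* `h0_zFree` — under hypothesis (4) of `stub_formDebordering` at `(n,m)`, no monomial of the support of
  `F` involves a variable outside the lower-right block other than `ℓ`.  Hence the test space of F1 is
  `{ℓ^a · G(Y)}` (with `G` content-homogeneous by the block torus, kernel at `(3,3)`:
  `FormDeborderingMargins33`), for every `n ≤ m`.

Refuter/theory seat `val-width-5779-d1` (stmt-ValiantsHypothesis-5779).  VP ≠ VNP is not touched.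
-/

open MvPolynomial Finset
open Literature.Computability.AlgebraicComplexity

namespace Summit.ValiantsHypothesis.Cruxes.ToricFixedPoints.Negative

/-- **Semi-invariants of `H₀(n,m)` are `z`-free.**  If `F` satisfies hypothesis (4) of
`stub_formDebordering` at `(n,m)` and `p` is a position with `¬((m-n ≤ p.1 ∧ m-n ≤ p.2) ∨ p = (0,0))`,
then `d p = 0` for every monomial `d` of the support of `F`. [folklore] -/
theorem h0_zFree (n m : ℕ) [NeZero m] {F : MvPolynomial (Fin m × Fin m) ℂ}
    (hH : ∀ A : Matrix.GeneralLinearGroup (Fin m × Fin m) ℂ,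
      let M : Matrix (Fin m × Fin m) (Fin m × Fin m) ℂ := A
      (∀ i j : Fin m × Fin m, M j i ≠ 0 →
        (fun p : Fin m × Fin m =>
            (if (m - n ≤ (p.1 : ℕ) ∧ m - n ≤ (p.2 : ℕ)) ∨ p = (0, 0) then 0 else m * m) +
              ((p.1 : ℕ) * m + (p.2 : ℕ))) j ≤
        (fun p : Fin m × Fin m =>
            (if (m - n ≤ (p.1 : ℕ) ∧ m - n ≤ (p.2 : ℕ)) ∨ p = (0, 0) then 0 else m * m) +
              ((p.1 : ℕ) * m + (p.2 : ℕ))) i) →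
      (∀ i j : Fin m × Fin m, ((m - n ≤ (i.1 : ℕ) ∧ m - n ≤ (i.2 : ℕ)) ∨ i = (0, 0)) →
        j ≠ i → M j i = 0) →
      (∀ i k j l : Fin m, m - n ≤ (i : ℕ) → m - n ≤ (k : ℕ) → m - n ≤ (j : ℕ) → m - n ≤ (l : ℕ) →
        M (i, j) (i, j) * M (k, l) (k, l) = M (i, l) (i, l) * M (k, j) (k, j)) →
      M (0, 0) (0, 0) ^ (m - n) * ∏ i ∈ Finset.univ.filter (fun i : Fin m => m - n ≤ (i : ℕ)),
        M (i, i) (i, i) = 1 →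
      ∃ e : ℂ, linSubst (Fin m × Fin m) ℂ M F = e • F)
    (p : Fin m × Fin m) (hp : ¬(((m - n ≤ (p.1 : ℕ)) ∧ (m - n ≤ (p.2 : ℕ))) ∨ p = (0, 0)))
    {d : (Fin m × Fin m) →₀ ℕ} (hd : d ∈ F.support) : d p = 0 := by
  classical
  set D := d p with hDdef
  by_contra hD
  have hall : ∀ d' ∈ F.support, d' p = D := fun d' hd' => h0_zExponent_eq n m hH p hp hd' hd
  have hp0 : p ≠ ((0 : Fin m), (0 : Fin m)) := fun h => hp (Or.inr h)
  have hF0 : F ≠ 0 := fun h => by rw [h, support_zero] at hd; simp at hd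
  -- the substitutions `X p ↦ q`
  let θ : MvPolynomial (Fin m × Fin m) ℂ → (Fin m × Fin m → MvPolynomial (Fin m × Fin m) ℂ) :=
    fun q i => if i = p then q else X i
  have hθ : ∀ q, aeval (θ q) F = q ^ D * aeval (θ 1) F := by
    intro q
    conv_lhs => rw [F.as_sum]
    conv_rhs => rw [F.as_sum]
    rw [map_sum, map_sum, Finset.mul_sum]
    refine Finset.sum_congr rfl fun d' hd' => ?_
    rw [aeval_monomial, aeval_monomial]
    have hp' : p ∈ d'.support := by rw [Finsupp.mem_support_iff, hall d' hd']; exact hD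
    have : d'.prod (fun i k => θ q i ^ k) = q ^ D * d'.prod (fun i k => θ 1 i ^ k) := by
      unfold Finsupp.prod
      rw [← Finset.mul_prod_erase _ _ hp', ← Finset.mul_prod_erase _ _ hp']
      simp only [θ, if_pos rfl, one_pow, one_mul, hall d' hd']
      congr 1
      exact Finset.prod_congr rfl fun i hi => by
        rw [if_neg (Finset.ne_of_mem_erase hi), if_neg (Finset.ne_of_mem_erase hi)]
    rw [this]
    ring
  set G := aeval (θ 1) F with hG
  -- factorisation `F = X_p^D · G`
  have hF : F = X p ^ D * G := by
    have h := hθ (X p)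
    have hid : θ (X p) = X := by
      funext i
      simp only [θ]
      split_ifs with h
      · rw [h]
      · rfl
    rwa [hid, aeval_X_left_apply] at h
  have hG0 : G ≠ 0 := fun h => hF0 (by rw [hF, h, mul_zero])
  -- the unipotent element `X p ↦ X p + ℓ`
  set T : Matrix (Fin m × Fin m) (Fin m × Fin m) ℂ := Matrix.transvection (0, 0) p 1 with hT
  have hTdet : T.det ≠ 0 := by
    rw [hT, Matrix.det_transvection_of_ne _ _ hp0.symm]; exact one_ne_zero
  have hTdiag : ∀ a, T a a = 1 := by
    intro a
    simp only [hT, Matrix.transvection, Matrix.add_apply, Matrix.one_apply_eq, Matrix.single_apply]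
    rw [if_neg, add_zero]
    rintro ⟨h1, h2⟩
    exact hp0 (h2.trans h1.symm)
  have hToff : ∀ a b, a ≠ b → T a b = if a = (0, 0) ∧ b = p then 1 else 0 := by
    intro a b hab
    simp only [hT, Matrix.transvection, Matrix.add_apply, Matrix.one_apply_ne hab, zero_add,
      Matrix.single_apply]
    by_cases h : a = (0, 0) ∧ b = p
    · rw [if_pos h, if_pos ⟨h.1.symm, h.2.symm⟩]
    · rw [if_neg h, if_neg fun h' => h ⟨h'.1.symm, h'.2.symm⟩]
  set A : Matrix.GeneralLinearGroup (Fin m × Fin m) ℂ :=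
    Matrix.GeneralLinearGroup.mkOfDetNeZero _ hTdet with hAdef
  have hA : (A : Matrix (Fin m × Fin m) (Fin m × Fin m) ℂ) = T := rfl
  have c1 : ∀ i j : Fin m × Fin m, (A : Matrix (Fin m × Fin m) (Fin m × Fin m) ℂ) j i ≠ 0 →
      (fun p : Fin m × Fin m =>
          (if (m - n ≤ (p.1 : ℕ) ∧ m - n ≤ (p.2 : ℕ)) ∨ p = (0, 0) then 0 else m * m) +
            ((p.1 : ℕ) * m + (p.2 : ℕ))) j ≤
      (fun p : Fin m × Fin m =>
          (if (m - n ≤ (p.1 : ℕ) ∧ m - n ≤ (p.2 : ℕ)) ∨ p = (0, 0) then 0 else m * m) +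
            ((p.1 : ℕ) * m + (p.2 : ℕ))) i := by
    intro i j h
    rw [hA] at h
    by_cases hji : j = i
    · rw [hji]
    · rw [hToff j i hji] at h
      by_cases hc : j = (0, 0) ∧ i = p
      · rw [hc.1]
        simp
      · exact absurd (if_neg hc) h
  have c2 : ∀ i j : Fin m × Fin m, ((m - n ≤ (i.1 : ℕ) ∧ m - n ≤ (i.2 : ℕ)) ∨ i = (0, 0)) →
      j ≠ i → (A : Matrix (Fin m × Fin m) (Fin m × Fin m) ℂ) j i = 0 := by
    intro i j hi hji
    rw [hA, hToff j i hji, if_neg]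
    rintro ⟨-, rfl⟩
    exact hp hi
  have c3 : ∀ i k j l : Fin m, m - n ≤ (i : ℕ) → m - n ≤ (k : ℕ) → m - n ≤ (j : ℕ) →
      m - n ≤ (l : ℕ) →
      (A : Matrix (Fin m × Fin m) (Fin m × Fin m) ℂ) (i, j) (i, j) *
          (A : Matrix (Fin m × Fin m) (Fin m × Fin m) ℂ) (k, l) (k, l) =
        (A : Matrix (Fin m × Fin m) (Fin m × Fin m) ℂ) (i, l) (i, l) *
          (A : Matrix (Fin m × Fin m) (Fin m × Fin m) ℂ) (k, j) (k, j) := by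
    intro i k j l _ _ _ _
    rw [hA, hTdiag, hTdiag, hTdiag, hTdiag]
  have c4 : (A : Matrix (Fin m × Fin m) (Fin m × Fin m) ℂ) (0, 0) (0, 0) ^ (m - n) *
      ∏ i ∈ Finset.univ.filter (fun i : Fin m => m - n ≤ (i : ℕ)),
        (A : Matrix (Fin m × Fin m) (Fin m × Fin m) ℂ) (i, i) (i, i) = 1 := by
    rw [hA, hTdiag, one_pow, one_mul]
    exact Finset.prod_eq_one fun i _ => hTdiag _
  obtain ⟨e, he⟩ := hH A c1 c2 c3 c4
  rw [hA] at he
  -- `T` acts as `X p ↦ X p + ℓ`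
  have hφ : linSubst (Fin m × Fin m) ℂ T = aeval (θ (X p + X ((0 : Fin m), (0 : Fin m)))) := by
    refine MvPolynomial.algHom_ext fun i => ?_
    rw [linSubst_X, aeval_X]
    rw [← Finset.add_sum_erase _ _ (Finset.mem_univ i), hTdiag, one_smul]
    by_cases hi : i = p
    · subst hi
      simp only [θ, if_pos rfl]
      rw [← Finset.add_sum_erase _ _ (Finset.mem_erase.2 ⟨hp0.symm, Finset.mem_univ _⟩),
        hToff _ _ hp0.symm, if_pos ⟨rfl, rfl⟩, one_smul,
        Finset.sum_eq_zero fun j hj => ?_, add_zero]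
      have hj1 : j ≠ (0, 0) := Finset.ne_of_mem_erase hj
      have hj2 : j ≠ i := Finset.ne_of_mem_erase (Finset.mem_of_mem_erase hj)
      rw [hToff _ _ hj2, if_neg fun h => hj1 h.1, zero_smul]
    · simp only [θ, if_neg hi]
      rw [Finset.sum_eq_zero fun j hj => ?_, add_zero]
      have hj2 : j ≠ i := Finset.ne_of_mem_erase hj
      rw [hToff _ _ hj2, if_neg fun h => hi h.2, zero_smul]
  rw [hφ, hθ] at he
  -- `(X p + ℓ)^D · G = e · X_p^D · G`, cancel `G`, kill `X p`
  rw [hF, ← smul_mul_assoc] at he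
  have hcancel := mul_right_cancel₀ hG0 he
  have hκ := congr_arg (aeval fun i : Fin m × Fin m =>
    if i = p then (0 : MvPolynomial (Fin m × Fin m) ℂ) else X i) hcancel
  simp only [map_pow, map_add, map_smul, aeval_X, if_true, if_neg hp0.symm, zero_add,
    zero_pow hD, smul_zero] at hκ
  exact pow_ne_zero D (X_ne_zero ((0 : Fin m), (0 : Fin m))) hκ

end Summit.ValiantsHypothesis.Cruxes.ToricFixedPoints.Negative
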